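import Summits.CriticalPhenomena.PercolationContinuityZ3.Theorems.SahiBoxTP2Coupling
import Summits.CriticalPhenomena.PercolationContinuityZ3.Theorems.SahiBoxTP2HilbertMarginals

/-!
# Box-TP₂ laws on the Hilbert cube `ℕ → [0,1]` are almost-everywhere-monotone images of `λ^ℕ`

Support file of the Sahi cell (`prim-sahi`, typer seat, generation 12; `--supports stmt-CriticalPhenomena-4575`).

THE COUPLING THEOREM ON THE HILBERT CUBE (`exists_aemonotone_coupling_hilbert`): every box-TP₂
(`SahiBoxTP2Split.IsBoxTP2`: `μ[a,b]·μ[a',b'] ≤ μ[a ⊓ a', b ⊓ b']·μ[a ⊔ a', b ⊔ b']` for all closed boxes; here on the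
sequence lattice `ℕ → [0,1]`, equivalently on every finite-dimensional marginal, `SahiBoxTP2HilbertMarginals.lean`)
probability measure `μ` on `ℕ → [0,1]` is `G_* λ^ℕ` for a BOREL map `G : (ℕ → [0,1]) → (ℕ → [0,1])` monotone, for the
coordinatewise order, on a set of full `λ^ℕ`-measure (`λ^ℕ = Measure.infinitePi (fun _ => volume)`).

Proof.  Generation 11 (`SahiBoxTP2Coupling.exists_aemonotone_coupling`) couples each marginal `μ_d` on `Q_d` to
`λ_d` by the standard (Rosenblatt) construction, but behind an `∃`.  Here the one-coordinate step is made explicit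
with a PRESCRIBED coupling of the first `d` coordinates (`stepMap`, with the compatibility
`initLast_stepMap_fst`: the first `d` coordinates of `G_{d+1} x` are `G_d` of the first `d` coordinates of `x`), the
a.e.-stochastically-increasing conditional kernels of `SahiBoxTP2Kernel.exists_aeCisKernel` are chosen once for every
`d` (`cisKer`), and the couplings `G_d = cplSeq d` of ALL marginals are built by recursion, hence compatible
(`initLast_cplSeq_succ_fst`).  They glue to `G u = (G_{k+1}(u_0,…,u_k)_k)_k` (`cplInf`, `finRestrict_cplInf`),
measurable, monotone on the intersection of the pulled-back good sets (full measure), and `G_* λ^ℕ` has the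
marginals `(G_d)_* λ_d = μ_d`, so equals `μ` by uniqueness of projective limits (`ext_of_map_finRestrict`).

Why only almost everywhere: already for two coordinates conditioned on two others no everywhere-monotone Borel
version need exist (generation 10/11); Sahi positivity only consumes the a.e. statement
(`SahiBoxTP2HilbertPositivity.lean`).  MTP₂ ⇒ CIS ⇒ monotone standard construction for densities in finite dimension
is [folklore] (Karlin–Rinott 1980, Rüschendorf 1981); lattice conditions for measures on general product measure
spaces: cf. Batty–Bollmann 1980 [cite: BattyBollmann1980].  The box form for singular laws on the Hilbert cube is this
work.  No sorries, no new axioms.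
-/

noncomputable section

namespace Summit.CriticalPhenomena.PercolationContinuityZ3.Theorems.SahiBoxTP2

open MeasureTheory ProbabilityTheory Set Filter Topology Function
open scoped ENNReal unitInterval

/-! ### The one-coordinate step of the standard construction, with a PRESCRIBED coupling of the first `d` coordinates -/

section Step

variable {d : ℕ} (G : (Fin d → I) → (Fin d → I)) (κ : Kernel (Fin d → I) I) [IsMarkovKernel κ]

/-- **One step of the standard construction** with a prescribed map `G` of the first `d` coordinates and a Markov
kernel `κ` for the last one: `x ↦ (G x', q_{κ(G x')}(x_d))` reassembled in `Q_{d+1}` (`x'` = the first `d`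
coordinates of `x`, `q` = the fibrewise quantile `KernelQuantile.kq`). -/
def stepMap : (Fin (d + 1) → I) → (Fin (d + 1) → I) :=
  fun x => (splitLast d).symm (KernelQuantile.kq κ (G (splitLast d x).2, (splitLast d x).1), G (splitLast d x).2)

/-- **Compatibility**: the first `d` coordinates of `stepMap G κ x` are `G` of the first `d` coordinates of `x`.
[this work] -/
theorem initLast_stepMap_fst (x : Fin (d + 1) → I) : (initLast (stepMap G κ x)).1 = G (initLast x).1 := by
  change (splitLast d ((splitLast d).symm _)).2 = _
  rw [MeasurableEquiv.apply_symm_apply]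
  rfl

/-- The last coordinate of `stepMap G κ x` is the fibrewise quantile. [this work] -/
theorem initLast_stepMap_snd (x : Fin (d + 1) → I) :
    (initLast (stepMap G κ x)).2 = KernelQuantile.kq κ (G (initLast x).1, (initLast x).2) := by
  change (splitLast d ((splitLast d).symm _)).1 = _
  rw [MeasurableEquiv.apply_symm_apply]
  rfl

/-- The step map as "pair map, then reassemble". [folklore] -/
theorem stepMap_eq_comp :
    stepMap G κ = (fun p : (Fin d → I) × I => (splitLast d).symm (p.2, p.1)) ∘
      ((((fun p : (Fin d → I) × I => (p.1, KernelQuantile.kq κ p)) ∘ Prod.map G id) ∘ Prod.swap) ∘ splitLast d) := by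
  funext x; rfl

variable {G}

/-- `stepMap G κ` is measurable for measurable `G`. [folklore] -/
theorem measurable_stepMap (hGm : Measurable G) : Measurable (stepMap G κ) := by
  rw [stepMap_eq_comp]
  exact ((splitLast d).symm.measurable.comp measurable_swap).comp
    ((((measurable_fst.prodMk (KernelQuantile.measurable_kq κ)).comp (hGm.prodMap measurable_id)).comp
      measurable_swap).comp (splitLast d).measurable)

/-- **The law of the step map**: `(stepMap G κ)_* λ_{d+1}` is `(G_* λ_d) ⊗ₘ κ` reassembled in `Q_{d+1}`. [this work] -/
theorem volume_map_stepMap (hGm : Measurable G) :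
    (volume : Measure (Fin (d + 1) → I)).map (stepMap G κ) =
      (((volume : Measure (Fin d → I)).map G) ⊗ₘ κ).map (fun p : (Fin d → I) × I => (splitLast d).symm (p.2, p.1)) := by
  have hstep : Measurable fun p : (Fin d → I) × I => (p.1, KernelQuantile.kq κ p) :=
    measurable_fst.prodMk (KernelQuantile.measurable_kq κ)
  have hGid : Measurable (Prod.map G (id : I → I)) := hGm.prodMap measurable_id
  have hsw : Measurable fun p : (Fin d → I) × I => (splitLast d).symm (p.2, p.1) :=
    (splitLast d).symm.measurable.comp measurable_swap
  have hinner : Measurable ((((fun p : (Fin d → I) × I => (p.1, KernelQuantile.kq κ p)) ∘ Prod.map G id) ∘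
      Prod.swap) ∘ splitLast d) := ((hstep.comp hGid).comp measurable_swap).comp (splitLast d).measurable
  have hev : (volume : Measure (Fin (d + 1) → I)).map (splitLast d) = (volume : Measure I).prod volume :=
    (volume_preserving_piFinSuccAbove (fun _ : Fin (d + 1) => I) (Fin.last d)).map_eq
  rw [stepMap_eq_comp, ← Measure.map_map hsw hinner, ← Measure.map_map ((hstep.comp hGid).comp measurable_swap)
    (splitLast d).measurable, hev, ← Measure.map_map (hstep.comp hGid) measurable_swap, Measure.prod_swap,
    ← Measure.map_map hstep hGid, ← Measure.map_prod_map _ _ hGm measurable_id, Measure.map_id,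
    KernelQuantile.map_prod_kq]

/-- **The step map is monotone almost everywhere** when `G` is monotone on a set of full measure and `κ` is
stochastically increasing on a set of full `G_* λ_d`-measure. [this work] -/
theorem exists_monotoneOn_stepMap (hGm : Measurable G) {S : Set (Fin d → I)}
    (hS : ∀ᵐ x ∂(volume : Measure (Fin d → I)), x ∈ S) (hG : MonotoneOn G S) {T : Set (Fin d → I)}
    (hT : ∀ᵐ a ∂((volume : Measure (Fin d → I)).map G), a ∈ T)
    (hκ : ∀ ⦃a b : Fin d → I⦄, a ∈ T → b ∈ T → a ≤ b → ∀ y : I, κ b (Iic y) ≤ κ a (Iic y)) :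
    ∃ S' : Set (Fin (d + 1) → I), (∀ᵐ x ∂(volume : Measure (Fin (d + 1) → I)), x ∈ S') ∧
      MonotoneOn (stepMap G κ) S' := by
  set e := splitLast d with he
  have hev : (volume : Measure (Fin (d + 1) → I)).map e = (volume : Measure I).prod volume :=
    (volume_preserving_piFinSuccAbove (fun _ : Fin (d + 1) => I) (Fin.last d)).map_eq
  set S₂ : Set (Fin d → I) := {y | y ∈ S ∧ G y ∈ T} with hS₂
  have hS₂ae : ∀ᵐ y ∂(volume : Measure (Fin d → I)), y ∈ S₂ := by
    filter_upwards [hS, ae_of_ae_map hGm.aemeasurable hT] with y h1 h2 using ⟨h1, h2⟩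
  refine ⟨{x | (e x).2 ∈ S₂}, ?_, ?_⟩
  · have hprod : ∀ᵐ p ∂((volume : Measure I).prod (volume : Measure (Fin d → I))), p.2 ∈ S₂ := by
      rw [ae_iff]
      have hset : {p : I × (Fin d → I) | ¬ p.2 ∈ S₂} = univ ×ˢ S₂ᶜ := by
        ext p
        simp only [mem_setOf_eq, mem_prod, mem_univ, mem_compl_iff, true_and]
      have h0 : (volume : Measure (Fin d → I)) S₂ᶜ = 0 := ae_iff.1 hS₂ae
      rw [hset, Measure.prod_prod, h0, mul_zero]
    rw [← hev] at hprod
    exact ae_of_ae_map e.measurable.aemeasurable hprod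
  · intro x hx y hy hxy
    have hexy : e x ≤ e y := splitLast_mono hxy
    have hG2 : G (e x).2 ≤ G (e y).2 := hG hx.1 hy.1 hexy.2
    refine splitLast_symm_mono (d := d) (show (_, G (e x).2) ≤ (_, G (e y).2) from ⟨?_, hG2⟩)
    rw [KernelQuantile.kq_apply, KernelQuantile.kq_apply]
    exact (UnitIntervalQuantile.quantile_mono (κ (G (e x).2)) hexy.1).trans
      (UnitIntervalQuantile.quantile_mono_measure _ _ (hκ hx.2 hy.2 hG2) _)

end Step

/-! ### A stochastically increasing (a.e.) conditional kernel of the last coordinate, valued in `[0,1]` -/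

section KernelI

variable {d : ℕ}

/-- **The conditional kernel of the last coordinate of a box-TP₂ law on `Q_{d+1}`**, valued in `[0,1]`,
disintegrating the law over its first `d` coordinates and stochastically increasing on a set of full measure
(`SahiBoxTP2Kernel.exists_aeCisKernel` on the cube, transferred to `[0,1]` by `compProd_map_projIcc_eq`).
[this work] -/
theorem exists_aeCisKernel_unitInterval (ν : Measure (Fin (d + 1) → I)) [IsProbabilityMeasure ν] (hν : IsBoxTP2 ν) :
    ∃ κ : Kernel (Fin d → I) I, IsMarkovKernel κ ∧ (ν.map initLast).fst ⊗ₘ κ = ν.map initLast ∧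
      ∃ T : Set (Fin d → I), (∀ᵐ a ∂(ν.map initLast).fst, a ∈ T) ∧
        ∀ ⦃a b : Fin d → I⦄, a ∈ T → b ∈ T → a ≤ b → ∀ y : I, κ b (Iic y) ≤ κ a (Iic y) := by
  obtain ⟨κ, hκM, hdis, T, hT, hκmono⟩ := exists_aeCisKernel hν.isBallTP2Cut_lawInitLastReal
  rw [fst_lawInitLastReal ν] at hdis hT
  have hproj : Measurable (projIcc (0 : ℝ) 1 zero_le_one) := continuous_projIcc.measurable
  haveI := Kernel.IsMarkovKernel.map κ hproj
  exact ⟨κ.map (projIcc (0 : ℝ) 1 zero_le_one), inferInstance, compProd_map_projIcc_eq (ν.map initLast) κ hdis, T, hT,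
    fun a b ha hb hab y => map_projIcc_Iic_le κ (hκmono ha hb hab) y⟩

end KernelI

/-! ### Compatible couplings of all marginals of a box-TP₂ law on the Hilbert cube -/

section Sequence

variable {μ : Measure (ℕ → I)} [IsProbabilityMeasure μ] (hμ : IsBoxTP2 μ)

/-- A chosen a.e.-stochastically-increasing conditional kernel of coordinate `d` given the first `d` coordinates. -/
def cisKer (d : ℕ) : Kernel (Fin d → I) I :=
  Classical.choose (exists_aeCisKernel_unitInterval (μ.map (finRestrict (d + 1))) (hμ.map_finRestrict_unitInterval _))

/-- The chosen kernel is Markov. -/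
instance instIsMarkovKernelCisKer (d : ℕ) : IsMarkovKernel (cisKer hμ d) :=
  (Classical.choose_spec (exists_aeCisKernel_unitInterval (μ.map (finRestrict (d + 1)))
    (hμ.map_finRestrict_unitInterval _))).1

/-- The chosen kernel disintegrates the `(d+1)`-marginal over the `d`-marginal. [this work] -/
theorem compProd_cisKer (d : ℕ) :
    (μ.map (finRestrict d)) ⊗ₘ cisKer hμ d = (μ.map (finRestrict (d + 1))).map initLast := by
  have h := (Classical.choose_spec (exists_aeCisKernel_unitInterval (μ.map (finRestrict (d + 1)))
    (hμ.map_finRestrict_unitInterval _))).2.1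
  rw [← fst_map_initLast_map_finRestrict_succ μ d]
  exact h

/-- The chosen kernel is stochastically increasing on a set of full `d`-marginal measure. [this work] -/
theorem exists_monotone_cisKer (d : ℕ) : ∃ T : Set (Fin d → I), (∀ᵐ a ∂μ.map (finRestrict d), a ∈ T) ∧
    ∀ ⦃a b : Fin d → I⦄, a ∈ T → b ∈ T → a ≤ b → ∀ y : I, cisKer hμ d b (Iic y) ≤ cisKer hμ d a (Iic y) := by
  have h := (Classical.choose_spec (exists_aeCisKernel_unitInterval (μ.map (finRestrict (d + 1)))
    (hμ.map_finRestrict_unitInterval _))).2.2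
  rw [← fst_map_initLast_map_finRestrict_succ μ d]
  exact h

/-- **The compatible couplings** `G_d : Q_d → Q_d` of the marginals: `G_0 = id`, `G_{d+1} = stepMap G_d κ_d`. -/
def cplSeq : (d : ℕ) → (Fin d → I) → (Fin d → I)
  | 0 => id
  | d + 1 => stepMap (cplSeq d) (cisKer hμ d)

/-- `G_{d+1} = stepMap G_d κ_d`. [folklore] -/
theorem cplSeq_succ (d : ℕ) : cplSeq hμ (d + 1) = stepMap (cplSeq hμ d) (cisKer hμ d) := rfl

/-- **Compatibility**: the first `d` coordinates of `G_{d+1} x` are `G_d` of the first `d` coordinates of `x`.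
[this work] -/
theorem initLast_cplSeq_succ_fst (d : ℕ) (x : Fin (d + 1) → I) :
    (initLast (cplSeq hμ (d + 1) x)).1 = cplSeq hμ d (initLast x).1 :=
  initLast_stepMap_fst _ _ x

/-- Each `G_d` is measurable. [folklore] -/
theorem measurable_cplSeq : ∀ d, Measurable (cplSeq hμ d)
  | 0 => measurable_id
  | d + 1 => measurable_stepMap (cisKer hμ d) (measurable_cplSeq d)

/-- **Each `G_d` pushes Lebesgue measure to the `d`-marginal**: `(G_d)_* λ_d = μ ∘ finRestrict_d⁻¹`. [this work] -/
theorem volume_map_cplSeq : ∀ d, (volume : Measure (Fin d → I)).map (cplSeq hμ d) = μ.map (finRestrict d)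
  | 0 => by
    rw [cplSeq, Measure.map_id]
    ext s hs
    by_cases hne : s.Nonempty
    · rw [Subsingleton.eq_univ_of_nonempty hne, measure_univ, measure_univ]
    · rw [not_nonempty_iff_eq_empty.1 hne, measure_empty, measure_empty]
  | d + 1 => by
    have hsw : Measurable fun p : (Fin d → I) × I => (splitLast d).symm (p.2, p.1) :=
      (splitLast d).symm.measurable.comp measurable_swap
    rw [cplSeq_succ, volume_map_stepMap (cisKer hμ d) (measurable_cplSeq hμ d), volume_map_cplSeq d,
      compProd_cisKer, Measure.map_map hsw measurable_initLast]
    convert Measure.map_id (μ := μ.map (finRestrict (d + 1))) using 2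
    funext x
    exact (splitLast d).symm_apply_apply x

/-- **Each `G_d` is monotone on a set of full Lebesgue measure.** [this work] -/
theorem exists_monotoneOn_cplSeq : ∀ d, ∃ S : Set (Fin d → I),
    (∀ᵐ x ∂(volume : Measure (Fin d → I)), x ∈ S) ∧ MonotoneOn (cplSeq hμ d) S
  | 0 => ⟨univ, ae_of_all _ fun x => mem_univ x, monotoneOn_id⟩
  | d + 1 => by
    obtain ⟨S, hS, hmono⟩ := exists_monotoneOn_cplSeq d
    obtain ⟨T, hT, hκ⟩ := exists_monotone_cisKer hμ d
    rw [← volume_map_cplSeq hμ d] at hT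
    exact exists_monotoneOn_stepMap (cisKer hμ d) (measurable_cplSeq hμ d) hS hmono hT hκ

end Sequence

/-! ### The coupling on the Hilbert cube -/

section Infinite

variable {μ : Measure (ℕ → I)} [IsProbabilityMeasure μ] (hμ : IsBoxTP2 μ)

/-- **The coupling on the Hilbert cube**: coordinate `k` of `G u` is the last coordinate of `G_{k+1}(u_0,…,u_k)`. -/
def cplInf (u : ℕ → I) : ℕ → I := fun k => cplSeq hμ (k + 1) (finRestrict (k + 1) u) (Fin.last k)

/-- **Compatibility with every finite stage**: the first `d` coordinates of `G u` are `G_d(u_0,…,u_{d-1})`.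
[this work] -/
theorem finRestrict_cplInf : ∀ (d : ℕ) (u : ℕ → I), finRestrict d (cplInf hμ u) = cplSeq hμ d (finRestrict d u)
  | 0 => fun u => Subsingleton.elim _ _
  | d + 1 => fun u => by
    funext i
    refine Fin.lastCases ?_ (fun j => ?_) i
    · rfl
    · have h1 : finRestrict (d + 1) (cplInf hμ u) (Fin.castSucc j) = finRestrict d (cplInf hμ u) j := rfl
      have h2 : cplSeq hμ (d + 1) (finRestrict (d + 1) u) (Fin.castSucc j) =
          (initLast (cplSeq hμ (d + 1) (finRestrict (d + 1) u))).1 j := by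
        change _ = Fin.removeNth (Fin.last d) (cplSeq hμ (d + 1) (finRestrict (d + 1) u)) j
        rw [Fin.removeNth_last]; rfl
      rw [h1, h2, initLast_cplSeq_succ_fst, initLast_finRestrict_succ, finRestrict_cplInf d u]

/-- The coupling is measurable. [folklore] -/
theorem measurable_cplInf : Measurable (cplInf hμ) :=
  measurable_pi_lambda _ fun k =>
    (measurable_pi_apply (Fin.last k)).comp ((measurable_cplSeq hμ (k + 1)).comp (measurable_finRestrict _))

/-- **The coupling is monotone on a set of full `λ^ℕ`-measure** (the intersection of the pulled-back good sets of
all finite stages). [this work] -/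
theorem exists_monotoneOn_cplInf : ∃ S : Set (ℕ → I), (∀ᵐ u ∂lebesgueHilbert, u ∈ S) ∧ MonotoneOn (cplInf hμ) S := by
  choose S hS hmono using exists_monotoneOn_cplSeq hμ
  refine ⟨⋂ d, finRestrict d ⁻¹' S d, ?_, ?_⟩
  · rw [show (⋂ d, finRestrict d ⁻¹' S d) = {u | ∀ d, u ∈ finRestrict d ⁻¹' S d} from by ext u; simp only [mem_iInter, mem_setOf_eq]]
    refine ae_all_iff.2 fun d => ?_
    have h := hS d
    rw [← lebesgueHilbert_map_finRestrict d] at h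
    exact ae_of_ae_map (measurable_finRestrict d).aemeasurable h
  · intro u hu v hv huv k
    rw [mem_iInter] at hu hv
    change finRestrict (k + 1) (cplInf hμ u) (Fin.last k) ≤ finRestrict (k + 1) (cplInf hμ v) (Fin.last k)
    rw [finRestrict_cplInf, finRestrict_cplInf]
    exact hmono (k + 1) (hu (k + 1)) (hv (k + 1)) (finRestrict_mono (k + 1) huv) (Fin.last k)

/-- **The coupling pushes `λ^ℕ` to `μ`** (all initial-segment marginals agree). [this work] -/
theorem lebesgueHilbert_map_cplInf : lebesgueHilbert.map (cplInf hμ) = μ := by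
  haveI : IsProbabilityMeasure (lebesgueHilbert.map (cplInf hμ)) :=
    Measure.isProbabilityMeasure_map (measurable_cplInf hμ).aemeasurable
  refine ext_of_map_finRestrict fun d => ?_
  rw [Measure.map_map (measurable_finRestrict d) (measurable_cplInf hμ),
    show finRestrict d ∘ cplInf hμ = cplSeq hμ d ∘ finRestrict d from funext (finRestrict_cplInf hμ d),
    ← Measure.map_map (measurable_cplSeq hμ d) (measurable_finRestrict d), lebesgueHilbert_map_finRestrict,
    volume_map_cplSeq]

end Infinite

/-! ### The coupling theorem on the Hilbert cube -/

/-- **THE COUPLING THEOREM ON THE HILBERT CUBE.** Every box-TP₂ probability measure `μ` on `ℕ → [0,1]`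
(coordinatewise order; singular laws allowed) is the image of the product of uniform laws `λ^ℕ` under a Borel map
`G : (ℕ → [0,1]) → (ℕ → [0,1])` that is monotone on a set of full `λ^ℕ`-measure: `μ = G_* λ^ℕ`.  (Compatible
standard constructions of all initial-segment marginals, `cplSeq`, glued along `ℕ`, `cplInf`; uniqueness of the
projective limit.)  Finite-dimensional case: `exists_aemonotone_coupling`.  MTP₂ ⇒ CIS ⇒ monotone standard
construction for densities in finite dimension is [folklore] (Karlin–Rinott 1980, Rüschendorf 1981); lattice
conditions for measures on general product spaces: cf. Batty–Bollmann 1980. [this work] -/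
theorem exists_aemonotone_coupling_hilbert (μ : Measure (ℕ → I)) [IsProbabilityMeasure μ] (hμ : IsBoxTP2 μ) :
    ∃ G : (ℕ → I) → (ℕ → I), ∃ S : Set (ℕ → I), Measurable G ∧ (∀ᵐ u ∂lebesgueHilbert, u ∈ S) ∧
      MonotoneOn G S ∧ lebesgueHilbert.map G = μ := by
  obtain ⟨S, hS, hmono⟩ := exists_monotoneOn_cplInf hμ
  exact ⟨cplInf hμ, S, measurable_cplInf hμ, hS, hmono, lebesgueHilbert_map_cplInf hμ⟩



end Summit.CriticalPhenomena.PercolationContinuityZ3.Theorems.SahiBoxTP2
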